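import Summits.QuantumFields.YangMills.Theorems.BalabanUVNodesN22W1StripOnDomain
import Literature.MathematicalPhysics.QuantumFieldTheory.Balaban1983to89.Node00.HistoryTermIndexedGenerator

/-!
# BalabanUVNodes ∕ node N22 = NE9 — THE W1 OBJECT ON THE RELATIVE-DISC CENTRED ROAD (RE-TYPING M1′), MODULE R1a: UNCENTRED HEREDITY — from PER-TERM schemas at
# the term-indexed generator to holomorphy + (1.18) of every generated term in every young coupling ON THE COUPLING's OWN DOMAIN (any domain family; a
# SECTOR for the relative-disc road), in node00-def-W1's `recTerm` currency — the CANONICAL complexification (module R1b: the CENTRED letter)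

Cell `pub-ymgap`, HUMAN RULING D-0062 (Track A), R134 ACCELERATION re-seat `pub-ymgap-dag-n22-c` (strategy s1), generation 6, file R1a of the re-typed line.  THEOREMS ONLY; imports
module 14′ `…N22W1StripOnDomain` (for the Lemma-3 socket `hRep_of_termwise` ∕ `h238_of_hRep_half` and S25 `analytic_and_bounded_locE_param_torus` in scope) and node00-def-W1 g6's
`Node00/HistoryTermIndexedGenerator` (`TermFun`, `GenTermFun`, `StepGen.ofTerms`, `GenTower.ofTerms`, `ofTerms_H`, `norm_H_ofTerms_le`, `differentiableOn_H_ofTerms`; g4's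
`recTerm`, `recTerm_succ`, `recTerm_congr_prefix`, `olderOf`) BY NAME.  `--supports` K3⁗ `SpineGivenEndpointR13Sep` (stmt-QuantumFields-20292) as a helper.

WHY.  Module R0 (`…N22W1RelCentredAtReading`) reduced `N22At` at the W1 reading of record to node N18 below + the CENTRED RELATIVE-DISC slot (A₂ᶜ) for the level functional: every
young-coupling section extends holomorphically to a set containing the relative discs `closedBall (t : ℂ) (c·t)` with a vertex value `e₀` and ‖F z − e₀‖ ≤ M·μ^{age}·t²·e^{−κd}.
THIS FILE produces that slot's content from PER-TERM hypotheses at print's term-indexed generator `GenTower.ofTerms L TF`, by induction on W1's recursion — in the currency in which the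
complexification is CANONICAL: for a real window history `g` the section in the coupling `g_i` IS `z ↦ recTerm (GenTower.ofTerms L TF) (↑g | i := z) j X φ` (node00-def-W1 g4:
`termC (toClusterTower G) j X g φ = recTerm G ↑g j X φ`), so no extension is chosen and no identity theorem is needed.  The domain of the coupling `g_i` is a member `D i` of an
ARBITRARY family of open sets containing the window points (the supplier of the last-coupling schema picks a SECTOR `⋃_t ball (t, c·t)` — print-faithful under possibility 1 of
[I] (2.9) — where this lineage's modules 14′–25′ forced one open set around uniform discs, i.e. around zero coupling: the located clause of `…N22W1StripLastTermwiseVertexRider`).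
§2 (UNCENTRED): the three per-term schemas — (S-last-T′) holomorphy + the (2.26) weight bound of `z ↦ TF k′ Z t z old φ` on `D k′` for every (1.18)-bounded older-term family,
(S-226-T′) the same for `z ↦ TF k′ Z t u (cv z) φ` on ANY open set along ANY holomorphic (1.18)-bounded older-term curve `cv` at ANY last coupling `u ∈ D k′` (structural, lens
T11: the older terms enter the last exponential of (2.14) linearly and print's majorant is phase-blind) — give, with the socket numerals + S25 + renewal, holomorphy AND (1.18) of
every level `j` in every young coupling `i < j` on `D i` (the pattern of g4's `analyticInEach_recTerm`, made quantitative by the canonical one-step bound of §1).  §4 (CENTRED): the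
NEW per-term VERTEX schema (S-vertex-T′) — a coupling-BLIND centre functional `V k′` (the one-sided limit at zero coupling; lens T13′: never the evaluation at `s = 0`, Lean junk
under the thresholds `ε₁∕‖s‖` of record) with ‖TF k′ Z t z old φ − V k′ Z t old φ‖ ≤ Mv·‖z‖²·weight·e^{a₅|Z|} on `D k′` (order two in `g` = order one in `s = g²`; [I] (2.13)
p. 268 «vanishes at `g_k = 0`» + p. 263 «C^∞ (or analytic)» made quantitative at complex coupling — NOT PRINTED), `V` itself obeying (S-226-T′) — gives the CENTRED letter of every
level w.r.t. the VERTEX TOWER (step `i`'s term functional replaced by `V i`): ‖recTerm G (↑g|i:=z₀) j X φ − recTerm G_V ↑g j X φ‖ ≤ 2·Mv·‖z₀‖²·A·e^{−κ d_j(X)} for `Mv‖z₀‖² ≤ ½`,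
UNIFORMLY IN THE AGE `j − i` (growth μ = 1).  Mechanism (§3–§4): the INTERPOLATION TOWER whose step-`i` term functional is `V i + (s∕ρ)·(TF i …z₀… − V i)` — at the mock coupling
`s = 0` the vertex tower, at `s = ρ` the true tower at `g_i = z₀`, affine hence entire in `s` with weight at most doubled on `ball 0 (ρ∕(Mv‖z₀‖²))` — to which §2 applies on that ball
(weight slack `2e^{a₅|Z|} ≤ e^{a₅′|Z|}` displayed, numerals at `a₅′`); Cauchy on `[0, ρ]` gives the letter, and the bound it divides by is §2's LEVEL-UNIFORM renewal amplitude `A` —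
no product of per-level Lipschitz constants ever forms.

INHABITATION NOTE (lens g9 rider V′, bus 2026-08-27 07:07Z).  The own-coupling socket (S-last-T′) asks holomorphy of `z ↦ TF k′ Z t z old φ` for the ABSTRACT family `TF` of this
file: it is inhabited by the ANALYTICALLY CONTINUED term functional (pre-scaling display [I] (2.10) p. 267, temperature `τ = 1∕g²`; lens T14), NOT by a box-keyed formula read at complex
coupling (thresholds `ε₁∕‖s‖` are real-valued in `s`, so `∂_{s̄} ≠ 0` already at window points).  The leaf (module R2) therefore displays these schemas for a CONTINUED family
`TFc` that AGREES WITH THE DATUM's `TF` ON THE REAL WINDOW — the generated towers then have the same real-history terms (§3-type congruence), which is all the reading sees.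

HONEST FRAMING.  Count-neutral by-name knit AT THE OBJECT; NOT a discharge of N22.  (S-last-T′), (S-226-T′), (S-vertex-T′) are DISPLAYED hypotheses on the term functional of record and
asserted nowhere; (S-vertex-T′) is NOT PRINTED (NE9's unprinted core at the last coupling, in the weakest analytic currency); NE9 NOT IN PRINT for d = 4; one finite four-torus
programme at fixed ε — NOT infinite volume, NOT OS on ℝ⁴, NOT a mass gap, NOT Clay.  0 `sorry`, 0 `def`, standard axioms.

References (TYPES only): [I] = [Balaban1987RG1] §0 p. 256, §1 p. 263, (2.9) p. 266, (2.10) p. 267, (2.13) p. 268; [II] = [Balaban1988RG2Cluster] (1.41) p. 11, (2.9)–(2.14) pp. 14–15,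
(2.26) p. 17, Lemma 3 (2.38) p. 20, (2.39)–(2.41) p. 21.
-/

noncomputable section

namespace YMDAG.N22.W1

open Set Metric
open scoped BigOperators
open Literature.MathematicalPhysics.QuantumFieldTheory.Balaban1983to89
open Literature.MathematicalPhysics.QuantumFieldTheory.Balaban1983to89.T4Continuum (T4Family)
open Literature.MathematicalPhysics.QuantumFieldTheory.Balaban1983to89.T4OutputRate
open Literature.MathematicalPhysics.QuantumFieldTheory.Balaban1983to89.B13Resummation (locE)
open Literature.MathematicalPhysics.QuantumFieldTheory.Balaban1983to89.TreeLengthTorus (TPt TDom tsys torusTreeLen torusTreeLen_nonneg)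
open Literature.MathematicalPhysics.QuantumFieldTheory.Balaban1983to89.TreeLengthTorusGeometry (TTouch)
open Literature.MathematicalPhysics.QuantumFieldTheory.Balaban1983to89.B12TreeDecay (K₀ K₀_pos)
open Literature.MathematicalPhysics.QuantumFieldTheory.Balaban1983to89.B13Lemma3TorusData (TBond)
open Literature.MathematicalPhysics.QuantumFieldTheory.Balaban1983to89.B13Lemma3Torus (TwoTorusStep)
open Literature.MathematicalPhysics.QuantumFieldTheory.Balaban1983to89.B13Lemma3TorusTerms (terms weight weight_nonneg)
open Literature.MathematicalPhysics.QuantumFieldTheory.Balaban1983to89.B13Lemma3TorusSocket (HRep Lemma3Numerics h238_of_hRep_half hRep_of_termwise)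
open Literature.MathematicalPhysics.QuantumFieldTheory.Balaban1983to89.Node00
open Literature.MathematicalPhysics.QuantumFieldTheory.Balaban1983to89.Node00.Sect2 (domSys domCount CPair)
open Literature.MathematicalPhysics.QuantumFieldTheory.Balaban1983to89.Node00.W1
open Summit.QuantumFields.BalabanUV.T4Continuum.NE1p.DressedOutputAnalyticFaces (analytic_and_bounded_locE_param_torus)

variable (F : T4Family) (K : ℕ) {𝔸 : Type*} {M : ℕ} [NeZero M] (L : ℕ) [NeZero L]

/-! ## §1 The canonical one-step bound: per-term holomorphy + (2.26) along a curve ⟹ holomorphy + (1.18) of the term-indexed generator's `E` along the curve -/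

open Classical in
/-- **ONE STEP ALONG A CURVE, CANONICALLY.**  For the term-indexed generator `StepGen.ofTerms L T` at step `k`, an open `O ⊂ ℂ`, a curve `z ↦ (u z, cv z)` in (last coupling, older
terms) and a configuration `φ`: if every term `z ↦ T Z t (u z) (cv z) φ`, `Z ⊆ X`, `t ∈ terms L M Z`, is holomorphic on `O` with `‖·‖ ≤ weight(t)·e^{a₅|Z|}` there, then — under the
socket's numerals, S25's two clauses at `A := C₃ε₁`, `R := (1−8δ)½Lκ` and the renewal `e·9·64·K₀(64,8)²·C₃ε₁ ≤ E₀` — the generated term `z ↦ (StepGen.ofTerms L T).E (u z) (cv z) φ X` is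
holomorphic on `O` with `‖·‖ ≤ E₀·e^{−κ d_{k+1}(X)}` there.  Module 14′ §2 on the CANONICAL complexified activity `Hc z Z := H(Z)(u z, cv z, φ)` (`ofTerms_H`, `norm_H_ofTerms_le`,
`differentiableOn_H_ofTerms`), the socket `hRep_of_termwise` + `h238_of_hRep_half`, S25 `analytic_and_bounded_locE_param_torus`; (2.13) is the same `locE` literal (`rfl`).
[cite: Balaban1988RG2Cluster, (2.9)-(2.14) pp.14-15, (2.26) p.17, Lemma 3 (2.38) p.20 and (2.39)-(2.41) p.21; Balaban1987RG1, (1.18) p.263] -/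
theorem holoBound_E_ofTerms_of_termwise {k : ℕ} (T : TermFun (F.P K) 𝔸 M k L) (c : B13.Consts) (hL : 8 ≤ c.L) (hLc : c.L = L)
    {a a₂ a₂' a₅ Aabs : ℝ} (hN : Lemma3Numerics c M ((c.L : ℝ) / 2) a a₂ a₂' a₅ Aabs) {E₀ κ r₁ : ℝ} (hA0 : 0 ≤ c.C3act * c.ε₁) (hr₁ : 0 ≤ r₁) (hκ : κ ≤ r₁)
    (hrate : r₁ + 2 * (64 * Real.log 162) + 2 ≤ (1 - 8 * c.δ) * ((c.L : ℝ) / 2) * c.κ)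
    (hsmall : c.C3act * c.ε₁ * Real.exp (5 * r₁ + 1) * K₀ 64 8 * 9 * 64 ≤ 1)
    (hrenew : Real.exp 1 * 9 * 64 * K₀ 64 8 ^ 2 * (c.C3act * c.ε₁) ≤ E₀)
    (u : ℂ → ℂ) (cv : ℂ → OlderTerms (F.P K) 𝔸 M k) (φ : CPair (F.P K) 𝔸) (X : (domSys (F.P K) M (k + 1)).Dom) (O : Set ℂ) (hO : IsOpen O)
    (hT : ∀ Z : (domSys (F.P K) M (k + 1)).Dom, Z.1 ⊆ X.1 → ∀ t ∈ terms L M Z,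
      DifferentiableOn ℂ (fun z => T Z t (u z) (cv z) φ) O ∧ ∀ z ∈ O, ‖T Z t (u z) (cv z) φ‖ ≤ weight L M c Z a t * Real.exp (a₅ * ((Z.1).card : ℝ))) :
    DifferentiableOn ℂ (fun z => (StepGen.ofTerms L T).E (u z) (cv z) φ X) O ∧
      ∀ z ∈ O, ‖(StepGen.ofTerms L T).E (u z) (cv z) φ X‖ ≤ E₀ * Real.exp (-(κ * torusTreeLen X.1)) := by
  -- the canonical complexified activity and term values
  set Hc : ℂ → TDom 4 (domCount (F.P K) M (k + 1)) → ℂ := fun z Z => (StepGen.ofTerms L T).H (u z) (cv z) φ Z with hHc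
  have hhol : ∀ Z : (domSys (F.P K) M (k + 1)).Dom, Z.1 ⊆ X.1 → DifferentiableOn ℂ (fun z => Hc z Z) O := fun Z hZ =>
    differentiableOn_H_ofTerms L T u cv (fun _ => φ) Z fun t ht => (hT Z hZ t ht).1
  have hdom : ∀ z ∈ O, ∀ Z : TDom 4 (domCount (F.P K) M (k + 1)), Z.1 ⊆ X.1 → ‖Hc z Z‖ ≤ ∑ t ∈ terms L M Z, ‖T Z t (u z) (cv z) φ‖ :=
    fun z _ Z _ => norm_H_ofTerms_le L T (u z) (cv z) φ Z
  -- (2.26) per term in resummed-index form at the strip step on `O` (configuration type `ℂ`, space `{z ∈ O | Z ⊆ X}`)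
  have hrep : HRep c M a a₅
      ({ volk := fun _ => 0, Φ := ℂ, Bond := PUnit, sp1 := fun _ => ∅, sp2 := fun Z => {z | z ∈ O ∧ Z.1 ⊆ X.1},
         Bv := fun _ _ => 0, Vp := fun _ _ => 0, V := fun _ _ => 0, Q := fun _ _ _ _ => 0, Vpp := fun _ _ => 0,
         H := fun Z z => Hc z Z, Ek1 := fun _ _ => 0, Elog := fun _ _ => 0, Analytic := fun _ _ => True,
         GaugeInv := fun _ => True, Repr17 := True, Restr := True } : TwoTorusStep 4 L (domCount (F.P K) M (k + 1))) :=
    hRep_of_termwise c (mul_nonneg hN.hα₆.le hN.hε₀) _ (fun Z t z => T Z t (u z) (cv z) φ) (fun Z z hz => hdom z hz.1 Z hz.2)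
      (fun Z z hz t ht => (hT Z hz.2 t ht).2 z hz.1)
  -- Lemma 3 on `O`: (2.38)
  have h238 := h238_of_hRep_half c hL hLc (N' := fun _ : ℕ => domCount (F.P K) M (k + 1)) (fun _ => _) M hN (fun _ => hrep) 0
  -- S25 on `O`
  have key := analytic_and_bounded_locE_param_torus (N := domCount (F.P K) M (k + 1)) (P := ℂ)
    (m := fun Z : (tsys 4 (domCount (F.P K) M (k + 1))).Dom => c.C3act * c.ε₁ * Real.exp (-((1 - 8 * c.δ) * ((c.L : ℝ) / 2) * c.κ * torusTreeLen Z.1)))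
    (act := Hc) (A := c.C3act * c.ε₁) (R := (1 - 8 * c.δ) * ((c.L : ℝ) / 2) * c.κ) (r₁ := r₁) X hO hA0 hr₁ hrate hsmall hhol
    (fun z hz Z hZ => h238 Z z ⟨hz, hZ⟩) (fun Z _ => le_rfl)
  have hM : 0 ≤ Real.exp 1 * 9 * 64 * K₀ 64 8 ^ 2 * (c.C3act * c.ε₁) := by positivity
  have hE : ∀ z, (StepGen.ofTerms L T).E (u z) (cv z) φ X =
      locE (TTouch (d := 4) (N := domCount (F.P K) M (k + 1))) (fun Z : (tsys 4 (domCount (F.P K) M (k + 1))).Dom => Z.1) (Hc z) X.1 := fun z => rfl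
  refine ⟨?_, fun z hz => ?_⟩
  · have h1 := key.1
    refine h1.congr fun z _ => hE z
  · rw [hE z]
    calc ‖locE (TTouch (d := 4) (N := domCount (F.P K) M (k + 1))) (fun Z : (tsys 4 (domCount (F.P K) M (k + 1))).Dom => Z.1) (Hc z) X.1‖
        ≤ Real.exp 1 * 9 * 64 * K₀ 64 8 ^ 2 * (c.C3act * c.ε₁) * Real.exp (-(r₁ * torusTreeLen X.1)) := key.2 z hz
      _ ≤ E₀ * Real.exp (-(κ * torusTreeLen X.1)) :=
          mul_le_mul hrenew (Real.exp_le_exp.2 (neg_le_neg (mul_le_mul_of_nonneg_right hκ (torusTreeLen_nonneg _)))) (Real.exp_nonneg _) (le_trans hM hrenew)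

/-! ## §2 UNCENTRED HEREDITY: holomorphy + (1.18) of every generated term in every young coupling, on the coupling's domain -/

open Classical in
/-- **HOLOMORPHY AND (1.18) OF EVERY LEVEL IN EVERY YOUNG COUPLING ON AN ARBITRARY DOMAIN FAMILY — W1's RECURSION, QUANTITATIVELY.**  For the term-indexed generator tower
`G := GenTower.ofTerms L TF`, space tables `sp`, the window `]0, γ]`, letters `A` (amplitude), `κ` (decay), a run length `Kr`, and a family `D i` of OPEN sets containing the window
points (the domain of the coupling `g_i`; a sector for the relative-disc road): IF at every step `k′ < Kr` (S-last-T′) for every (1.18)-bounded older-term family `old` (complex values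
allowed) and every `X`, `φ ∈ sp (k′+1) X`, `Z ⊆ X`, `t ∈ terms L M Z` the term `z ↦ TF k′ Z t z old φ` is holomorphic on `D k′` with the (2.26) weight bound there, and (S-226-T′) for
every older coupling `i < k′`, every last coupling `u ∈ D k′` and every older-term curve `cv` holomorphic and (1.18)-bounded on `D i` along the tables, the term `z ↦ TF k′ Z t u (cv z) φ`
is holomorphic on `D i` with the weight bound — THEN (socket numerals + S25 + renewal `… ≤ A`) at every level `j ≤ Kr`, for every real window history `g`, `X ∈ 𝐃_j`, `φ ∈ sp j X`:
(a) `‖recTerm G ↑g j X φ‖ ≤ A·e^{−κ d_j(X)}` and (b) for every `i < j` the CANONICAL section `z ↦ recTerm G (↑g | i := z) j X φ` is holomorphic on `D i` and (1.18)-bounded there.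
Proof = node00-def-W1 g4's `analyticInEach_recTerm` made quantitative: the levels `≤ i` do not read `g_i` (`recTerm_congr_prefix`); level `i+1` reads it as its last coupling
((S-last-T′) + §1 with a constant older-term curve); the higher levels read it through the older terms only (`recTerm_succ`; (S-226-T′) + §1 along the generated older-term curve);
(a) is (b) at the window point `z = g_{j−1}`. [cite: Balaban1987RG1, §0 p.256, §1 p.263, p.266 and (2.13) p.268; Balaban1988RG2Cluster, (1.41) p.11, (2.14) p.15, (2.26) p.17 and (2.39)-(2.41) p.21] -/
theorem holoBound_recTerm_ofTerms (TF : GenTermFun (F.P K) 𝔸 M L) (sp : (j : ℕ) → (domSys (F.P K) M j).Dom → Set (CPair (F.P K) 𝔸))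
    (c : B13.Consts) (hL : 8 ≤ c.L) (hLc : c.L = L) {a a₂ a₂' a₅ Aabs : ℝ} (hN : Lemma3Numerics c M ((c.L : ℝ) / 2) a a₂ a₂' a₅ Aabs)
    {γ A κ r₁ : ℝ} (hA0 : 0 ≤ c.C3act * c.ε₁) (hr₁ : 0 ≤ r₁) (hκ : κ ≤ r₁)
    (hrate : r₁ + 2 * (64 * Real.log 162) + 2 ≤ (1 - 8 * c.δ) * ((c.L : ℝ) / 2) * c.κ)
    (hsmall : c.C3act * c.ε₁ * Real.exp (5 * r₁ + 1) * K₀ 64 8 * 9 * 64 ≤ 1)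
    (hrenew : Real.exp 1 * 9 * 64 * K₀ 64 8 ^ 2 * (c.C3act * c.ε₁) ≤ A)
    (D : ℕ → Set ℂ) (hDo : ∀ i, IsOpen (D i)) (hDw : ∀ (i : ℕ), ∀ t ∈ Ioc (0 : ℝ) γ, ((t : ℝ) : ℂ) ∈ D i) (Kr : ℕ)
    (hlast : ∀ k' : ℕ, k' < Kr → ∀ old : OlderTerms (F.P K) 𝔸 M k',
      (∀ (j : Fin (k' + 1)) (Y : (domSys (F.P K) M j).Dom) (ψ : CPair (F.P K) 𝔸), ψ ∈ sp j Y → ‖old j Y ψ‖ ≤ A * Real.exp (-(κ * torusTreeLen Y.1))) →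
      ∀ (X : (domSys (F.P K) M (k' + 1)).Dom) (φ : CPair (F.P K) 𝔸), φ ∈ sp (k' + 1) X → ∀ (Z : (domSys (F.P K) M (k' + 1)).Dom), Z.1 ⊆ X.1 → ∀ t ∈ terms L M Z,
        DifferentiableOn ℂ (fun z => TF k' Z t z old φ) (D k') ∧ ∀ z ∈ D k', ‖TF k' Z t z old φ‖ ≤ weight L M c Z a t * Real.exp (a₅ * ((Z.1).card : ℝ)))
    (hprop : ∀ k' : ℕ, k' < Kr → ∀ i : ℕ, i < k' → ∀ u ∈ D k', ∀ cv : ℂ → OlderTerms (F.P K) 𝔸 M k',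
      (∀ (j : Fin (k' + 1)) (Y : (domSys (F.P K) M j).Dom) (ψ : CPair (F.P K) 𝔸), ψ ∈ sp j Y →
        DifferentiableOn ℂ (fun z => cv z j Y ψ) (D i) ∧ ∀ z ∈ D i, ‖cv z j Y ψ‖ ≤ A * Real.exp (-(κ * torusTreeLen Y.1))) →
      ∀ (X : (domSys (F.P K) M (k' + 1)).Dom) (φ : CPair (F.P K) 𝔸), φ ∈ sp (k' + 1) X → ∀ (Z : (domSys (F.P K) M (k' + 1)).Dom), Z.1 ⊆ X.1 → ∀ t ∈ terms L M Z,
        DifferentiableOn ℂ (fun z => TF k' Z t u (cv z) φ) (D i) ∧ ∀ z ∈ D i, ‖TF k' Z t u (cv z) φ‖ ≤ weight L M c Z a t * Real.exp (a₅ * ((Z.1).card : ℝ))) :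
    ∀ (j : ℕ), j ≤ Kr → ∀ (g : ℕ → ℝ), g ∈ Window γ → ∀ (X : (domSys (F.P K) M j).Dom) (φ : CPair (F.P K) 𝔸), φ ∈ sp j X →
      ‖recTerm (GenTower.ofTerms L TF) (fun n => ((g n : ℝ) : ℂ)) j X φ‖ ≤ A * Real.exp (-(κ * torusTreeLen X.1)) ∧
      ∀ i : ℕ, i < j →
        DifferentiableOn ℂ (fun z => recTerm (GenTower.ofTerms L TF) (Function.update (fun n => ((g n : ℝ) : ℂ)) i z) j X φ) (D i) ∧
        ∀ z ∈ D i, ‖recTerm (GenTower.ofTerms L TF) (Function.update (fun n => ((g n : ℝ) : ℂ)) i z) j X φ‖ ≤ A * Real.exp (-(κ * torusTreeLen X.1)) := by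
  set G : GenTower (F.P K) 𝔸 M := GenTower.ofTerms L TF with hG
  have hApos : 0 ≤ A := le_trans (by positivity) hrenew
  -- strong induction on the level, packaged as `∀ n, ∀ j ≤ n, …`
  suffices h : ∀ (n j : ℕ), j ≤ n → j ≤ Kr → ∀ (g : ℕ → ℝ), g ∈ Window γ → ∀ (X : (domSys (F.P K) M j).Dom) (φ : CPair (F.P K) 𝔸), φ ∈ sp j X →
      ‖recTerm G (fun n => ((g n : ℝ) : ℂ)) j X φ‖ ≤ A * Real.exp (-(κ * torusTreeLen X.1)) ∧
      ∀ i : ℕ, i < j →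
        DifferentiableOn ℂ (fun z => recTerm G (Function.update (fun n => ((g n : ℝ) : ℂ)) i z) j X φ) (D i) ∧
        ∀ z ∈ D i, ‖recTerm G (Function.update (fun n => ((g n : ℝ) : ℂ)) i z) j X φ‖ ≤ A * Real.exp (-(κ * torusTreeLen X.1)) from
    fun j hj => h j j le_rfl hj
  intro n
  induction n with
  | zero =>
    intro j hj _ g _ X φ _
    obtain rfl : j = 0 := Nat.le_zero.mp hj
    refine ⟨?_, fun i hi => absurd hi (Nat.not_lt_zero i)⟩
    rw [recTerm_zero, norm_zero]
    positivity
  | succ n ih =>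
    intro j hj hjK g hg X φ hφ
    rcases Nat.lt_succ_iff_lt_or_eq.mp (Nat.lt_succ_of_le hj) with hjn | rfl
    · exact ih j (Nat.lt_succ_iff.mp hjn) hjK g hg X φ hφ
    · rcases Nat.eq_zero_or_eq_succ_pred (n + 1) with h0 | hsucc
      · exact absurd h0 (Nat.succ_ne_zero n)
      · -- level `n + 1 = k' + 1` with `k' = n < Kr`
        have hk' : n < Kr := Nat.lt_of_succ_le hjK
        set gc : ℕ → ℂ := fun m => ((g m : ℝ) : ℂ) with hgc
        -- (1.18) of the generated older terms at the real history (induction hypothesis (a) at the levels `≤ n`)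
        have holdB : ∀ (j' : Fin (n + 1)) (Y : (domSys (F.P K) M j').Dom) (ψ : CPair (F.P K) 𝔸), ψ ∈ sp j' Y →
            ‖olderOf (recTerm G gc) n j' Y ψ‖ ≤ A * Real.exp (-(κ * torusTreeLen Y.1)) := fun j' Y ψ hψ =>
          (ih j'.1 (Nat.lt_succ_iff.mp j'.2) ((Nat.le_of_lt_succ j'.2).trans hk'.le) g hg Y ψ hψ).1
        -- (b): every young coupling `i < n + 1`
        have hb : ∀ i : ℕ, i < n + 1 →
            DifferentiableOn ℂ (fun z => recTerm G (Function.update gc i z) (n + 1) X φ) (D i) ∧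
            ∀ z ∈ D i, ‖recTerm G (Function.update gc i z) (n + 1) X φ‖ ≤ A * Real.exp (-(κ * torusTreeLen X.1)) := by
          intro i hi
          rcases Nat.lt_succ_iff_lt_or_eq.mp hi with hin | rfl
          · -- an OLDER coupling `i < n`: through the older terms only
            set cv : ℂ → OlderTerms (F.P K) 𝔸 M n := fun z => olderOf (recTerm G (Function.update gc i z)) n with hcv
            have hsec : ∀ z, recTerm G (Function.update gc i z) (n + 1) X φ = (StepGen.ofTerms L (TF n)).E (gc n) (cv z) φ X := by
              intro z
              rw [recTerm_succ, Function.update_of_ne (ne_of_gt hin)]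
              rfl
            have hcvB : ∀ (j' : Fin (n + 1)) (Y : (domSys (F.P K) M j').Dom) (ψ : CPair (F.P K) 𝔸), ψ ∈ sp j' Y →
                DifferentiableOn ℂ (fun z => cv z j' Y ψ) (D i) ∧ ∀ z ∈ D i, ‖cv z j' Y ψ‖ ≤ A * Real.exp (-(κ * torusTreeLen Y.1)) := by
              intro j' Y ψ hψ
              have hj'K : j'.1 ≤ Kr := (Nat.le_of_lt_succ j'.2).trans hk'.le
              by_cases hij : i < j'.1
              · exact (ih j'.1 (Nat.lt_succ_iff.mp j'.2) hj'K g hg Y ψ hψ).2 i hij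
              · have hconst : ∀ z, cv z j' Y ψ = recTerm G gc j'.1 Y ψ := fun z =>
                  recTerm_congr_prefix G j'.1 (fun m hm => Function.update_of_ne (Nat.ne_of_lt (lt_of_lt_of_le hm (Nat.not_lt.1 hij))) z gc) Y ψ
                refine ⟨(differentiableOn_const (recTerm G gc j'.1 Y ψ)).congr fun z _ => hconst z, fun z _ => ?_⟩
                rw [hconst z]
                exact (ih j'.1 (Nat.lt_succ_iff.mp j'.2) hj'K g hg Y ψ hψ).1
            have key := holoBound_E_ofTerms_of_termwise F K L (TF n) c hL hLc hN hA0 hr₁ hκ hrate hsmall hrenew (fun _ => gc n) cv φ X (D i) (hDo i)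
              (hprop n hk' i hin (gc n) (hDw n (g n) (hg n)) cv hcvB X φ hφ)
            exact ⟨key.1.congr fun z _ => hsec z, fun z hz => by rw [hsec z]; exact key.2 z hz⟩
          · -- the LAST coupling `g_n` of step `n`: the older terms do not read it
            have hsec : ∀ z, recTerm G (Function.update gc i z) (i + 1) X φ = (StepGen.ofTerms L (TF i)).E z (olderOf (recTerm G gc) i) φ X := by
              intro z
              rw [recTerm_succ, Function.update_self]
              refine congrArg (fun old => (StepGen.ofTerms L (TF i)).E z old φ X) ?_
              funext j' Y ψ
              exact recTerm_congr_prefix G j'.1 (fun m hm => Function.update_of_ne (Nat.ne_of_lt (lt_of_lt_of_le hm (Nat.le_of_lt_succ j'.2))) z gc) Y ψ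
            have key := holoBound_E_ofTerms_of_termwise F K L (TF i) c hL hLc hN hA0 hr₁ hκ hrate hsmall hrenew (fun z => z)
              (fun _ => olderOf (recTerm G gc) i) φ X (D i) (hDo i) (hlast i hk' _ holdB X φ hφ)
            exact ⟨key.1.congr fun z _ => hsec z, fun z hz => by rw [hsec z]; exact key.2 z hz⟩
        refine ⟨?_, hb⟩
        -- (a): (b) at the window point `z = g_n`
        have h := (hb n (Nat.lt_succ_self n)).2 (gc n) (hDw n (g n) (hg n))
        rwa [Function.update_eq_self] at h


end YMDAG.N22.W1

end
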